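import Summits.QuantumFields.YangMills.Theorems.UnitScaleTiltProp7TwistedDefectDampedLevelMasses
import Summits.QuantumFields.YangMills.Theorems.UnitScaleTiltProp7TwistedOneStepLinL1OfRegPr
import HarnessLib

/-!
# Route `UnitScaleTilt`, crux K1 «MinimiserStabilityRegPr» (stmt-QuantumFields-19200), route-R E′ (A′) «HCOW-VIA-Σ», package P-A2 «JOINT-Σ», (β) lane (REM2ˢ, px13 g6 F-β) —
# **THE LEVEL-`k` TRUNCATED DEFECT TELESCOPE OF THE COVARIANT LOG TOWER**: for every intermediate level `k` (not only the top `k = K − n` of F0″),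
# `Σ_{c : PBond (F.P K) k} ‖(Fm k X − Lin k X) c‖ ≤ Σ_{l<k} κ^{k−1−l} · Σ_{c′} ‖defect_l(Fm l X) c′‖`, and, at the member, with the explicit damping `κ = L⁻² + 2·10¹⁵·L³·ε₀` and the
# one-step defect priced in level-mass currency, `… ≤ Σ_{l<k} κ^{k−1−l} · (10⁹L⁴ · Σ_b ‖Fm l X b‖²)` for `k ≤ K − n`.

Cell `ym3-torus`, D-0154 (3c) twin-width seat `ym-routeR-w3` (gen 7); `--supports stmt-QuantumFields-19200 --as helper`, count-neutral, def-free.  YM₃ on T³ is a ladder rung (R3),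
NOT the Clay problem; nothing here is a claim about the stub, the crux, d = 4 or the mass gap.

WHY (px13 g6 LOCATE #57 «R0-RECURSION» §2–§3, 2026-08-29).  The second-order frame remainder REM2ˢ of the (β) lane reads, at EVERY level `k < K − n`, the stair row `S_k` whose analytic input per
link is `exp(Fm k X b) − 1 − Lin k X b = [exp F − 1 − F] + [Fm k X − Lin k X](b)` — the second bracket is the (S)-chain's ACCUMULATED one-step defect truncated at level `k`.  F0″
(✓`Prop7CovLogTower.l1_CmapTwS_le_damped_defects`, ✓`Prop7CovLogTowerOfRegPr.l1_CmapTwS_le_damped_defects_of_regPr`, ✓`Prop7CovLogTowerDampedOfRegPr.…_damped`) names only the TOP instance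
(`k = K − n`, re-indexed to `CmapTwS`); this file names the intermediate one, in F0″'s letters token for token, so F-β cites a decl instead of re-running the telescope.

WHAT THIS FILE PROVES (sorry-free; three compositions of LANDED decls).
* ★★ **`l1_iterate_sub_lin_le_damped_defects`** — PURE ALGEBRA (no `RegPr`, no window): for the formal towers `Fm`, `Lin` of ✓`Prop7CovLogTower.exists_iterate`∕`exists_lin` over ANY background
  `U₀`, any `κ ≥ 0` with the column-sum letter `hT` for the levels `m < k` only, and any `X`:
  `Σ_{c : PBond (F.P K) k} ‖(Fm k X − Lin k X) c‖ ≤ Σ_{l ∈ range k} κ^{k−1−l} · Σ_{c′} ‖(Φ_l (Fm l X) − fderiv Φ_l 0 (Fm l X)) c′‖`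
  (★px18 g3 ✓`IteratedMapTelescope.l1_orbit_sub_lin_le_pow_of_lt` at the orbit `m ↦ Fm m X`, then `Fm 0 X = X`).
* ★★★ **`l1_iterate_sub_lin_le_damped_defects_of_regPr`** — AT THE MEMBER, `κ := (L²)⁻¹ + 2·10¹⁵·L³·ε₀` (this seat's F2″-COV ✓`Prop7TwistedOneStepLinL1OfRegPr.sum_norm_fderiv_dbarChartField_apply_le_of_regPr`
  discharges `hT` for `m < k ≤ K − n`; window `10¹³L³ε₀ ≤ 1`), still no window on `X`.
* ★★★ **`l1_iterate_sub_lin_le_damped_levelMasses_of_regPr`** — the same with the one-step defect priced in (★routeR-w6 g7's SUP-SEAM ✓`Prop7TwistedDefectDampedLevelMasses.norm_iterate_apply_le_of_regPr`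
  ∘ ★px15 g3 ✓`Prop7TwistedOneStepDefectOfRegPr.sum_norm_chartField_sub_fderiv_apply_le_of_regPr`): for `0 < e`, `10⁹L²e ≤ 1`, `10¹³L³ε₀ ≤ 1`, `‖X‖ < e·η`, `k ≤ K − n`,
  `Σ_c ‖(Fm k X − Lin k X) c‖ ≤ Σ_{l<k} κ^{k−1−l} · (10⁹L⁴ · Σ_b ‖Fm l X b‖²)`.
HONEST SCOPE.  Compositions only; the top instance re-derives ✓p697009's two theorems before the `CmapTwS` re-indexing.  Nothing of REM2ˢ, (β), hPA2, hcoS, E′, EX or the crux is claimed.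

References: T. Bałaban, CMP **98** (1985) 17–51 [Balaban1985Averaging] ((125)–(127) p.36, (150)–(152) p.40); CMP **102** (1985) 277–309 [Balaban1985Variational] ((44)–(46) p.285,
(146) p.301); CMP **95** (1984) 17–40 [Balaban1984PropagatorsI] ((1.18)–(1.20) pp.19–20).
-/

set_option autoImplicit false

noncomputable section

open scoped BigOperators Matrix.Norms.L2Operator

namespace Summit.QuantumFields.YangMills.Theorems.Prop7CovLogTowerDampedLevelK

open NormedSpace
open Literature.MathematicalPhysics.QuantumFieldTheory.Balaban1983to89
open Literature.MathematicalPhysics.QuantumFieldTheory.Balaban1983to89.T3ContinuumYM3Torus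
open T4Continuum BlockAveraging AveragingRT ExpMeanLog
open MatrixLog (mlog)
open B7Prop1Explicit (expUnit val_expUnit)
open T3PrintedRegularMinimiser (RegPr)
open T3SectALandauChart (eta eta_pos bgUnits pos_of_regPr)
open Summit.QuantumFields.YangMills.Theorems.Prop8Chart (emlAvgU emlIterU)
open Summit.QuantumFields.YangMills.Theorems.Prop7SymAvgTwSym (dbarCovU)
open Summit.QuantumFields.YangMills.Theorems.IteratedMapTelescope (l1_orbit_sub_lin_le_pow_of_lt)
open Summit.QuantumFields.YangMills.Theorems.Prop7TwistedDefectDampedLevelMasses (norm_iterate_apply_le_of_regPr)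
open Summit.QuantumFields.YangMills.Theorems.Prop7TwistedOneStepDefectOfRegPr (sum_norm_chartField_sub_fderiv_apply_le_of_regPr)
open Summit.QuantumFields.YangMills.Theorems.Prop7TwistedOneStepLinL1OfRegPr (sum_norm_fderiv_dbarChartField_apply_le_of_regPr)

variable (F : T3Family) {n K : ℕ}

/-- ★★ **THE LEVEL-`k` TRUNCATED DEFECT TELESCOPE — PURE ALGEBRA.**  For the formal towers `Fm`, `Lin` over any background `U₀` and any `κ ≥ 0` carrying the column-sum letter of the
one-step linear parts for the levels `m < k` only:
`Σ_{c : PBond (F.P K) k} ‖(Fm k X − Lin k X) c‖ ≤ Σ_{l<k} κ^{k−1−l} · Σ_{c′} ‖(Φ_{V_l}(Fm l X) − DΦ_{V_l}(0)(Fm l X)) c′‖`.  No window on `X`, no regularity of `U₀`.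
[cite: Balaban1985Averaging, (150)-(152) p.40; Balaban1985Variational, (44) p.285] -/
theorem l1_iterate_sub_lin_le_damped_defects (U₀ : GaugeField (F.P K) 0 (Matrix.specialUnitaryGroup (Fin 2) ℂ))
    (Fm : (m : ℕ) → (PBond (F.P K) 0 → Matrix (Fin 2) (Fin 2) ℂ) → (PBond (F.P K) m → Matrix (Fin 2) (Fin 2) ℂ)) (hF0 : ∀ x, Fm 0 x = x)
    (hFs : ∀ (m : ℕ) (x : PBond (F.P K) 0 → Matrix (Fin 2) (Fin 2) ℂ), Fm (m + 1) x =
        (fun y : PBond (F.P K) m → Matrix (Fin 2) (Fin 2) ℂ => fun c : PBond (F.P K) (m + 1) =>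
          mlog (((dbarCovU (emlIterU m (bgUnits F K U₀)) (fun b => expUnit (y b) * emlIterU m (bgUnits F K U₀) b) c : (Matrix (Fin 2) (Fin 2) ℂ)ˣ) : Matrix (Fin 2) (Fin 2) ℂ) *
            (((emlAvgU (emlIterU m (bgUnits F K U₀)) c)⁻¹ : (Matrix (Fin 2) (Fin 2) ℂ)ˣ) : Matrix (Fin 2) (Fin 2) ℂ))) (Fm m x))
    (Lin : (m : ℕ) → (PBond (F.P K) 0 → Matrix (Fin 2) (Fin 2) ℂ) →L[ℂ] (PBond (F.P K) m → Matrix (Fin 2) (Fin 2) ℂ))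
    (hLin0 : Lin 0 = ContinuousLinearMap.id ℂ (PBond (F.P K) 0 → Matrix (Fin 2) (Fin 2) ℂ))
    (hLins : ∀ m : ℕ, Lin (m + 1) =
        (fderiv ℂ (fun y : PBond (F.P K) m → Matrix (Fin 2) (Fin 2) ℂ => fun c : PBond (F.P K) (m + 1) =>
          mlog (((dbarCovU (emlIterU m (bgUnits F K U₀)) (fun b => expUnit (y b) * emlIterU m (bgUnits F K U₀) b) c : (Matrix (Fin 2) (Fin 2) ℂ)ˣ) : Matrix (Fin 2) (Fin 2) ℂ) *
            (((emlAvgU (emlIterU m (bgUnits F K U₀)) c)⁻¹ : (Matrix (Fin 2) (Fin 2) ℂ)ˣ) : Matrix (Fin 2) (Fin 2) ℂ))) 0).comp (Lin m))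
    {κ : ℝ} (hκ : 0 ≤ κ) (k : ℕ)
    (hT : ∀ m : ℕ, m < k → ∀ v : PBond (F.P K) m → Matrix (Fin 2) (Fin 2) ℂ, ∑ c, ‖fderiv ℂ (fun y : PBond (F.P K) m → Matrix (Fin 2) (Fin 2) ℂ => fun c : PBond (F.P K) (m + 1) =>
          mlog (((dbarCovU (emlIterU m (bgUnits F K U₀)) (fun b => expUnit (y b) * emlIterU m (bgUnits F K U₀) b) c : (Matrix (Fin 2) (Fin 2) ℂ)ˣ) : Matrix (Fin 2) (Fin 2) ℂ) *
            (((emlAvgU (emlIterU m (bgUnits F K U₀)) c)⁻¹ : (Matrix (Fin 2) (Fin 2) ℂ)ˣ) : Matrix (Fin 2) (Fin 2) ℂ))) 0 v c‖ ≤ κ * ∑ c', ‖v c'‖)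
    (X : PBond (F.P K) 0 → Matrix (Fin 2) (Fin 2) ℂ) :
    ∑ c : PBond (F.P K) k, ‖(Fm k X - Lin k X) c‖ ≤
      ∑ l ∈ Finset.range k, κ ^ (k - 1 - l) * ∑ c', ‖((fun y : PBond (F.P K) l → Matrix (Fin 2) (Fin 2) ℂ => fun c : PBond (F.P K) (l + 1) =>
          mlog (((dbarCovU (emlIterU l (bgUnits F K U₀)) (fun b => expUnit (y b) * emlIterU l (bgUnits F K U₀) b) c : (Matrix (Fin 2) (Fin 2) ℂ)ˣ) : Matrix (Fin 2) (Fin 2) ℂ) *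
            (((emlAvgU (emlIterU l (bgUnits F K U₀)) c)⁻¹ : (Matrix (Fin 2) (Fin 2) ℂ)ˣ) : Matrix (Fin 2) (Fin 2) ℂ))) (Fm l X) -
        fderiv ℂ (fun y : PBond (F.P K) l → Matrix (Fin 2) (Fin 2) ℂ => fun c : PBond (F.P K) (l + 1) =>
          mlog (((dbarCovU (emlIterU l (bgUnits F K U₀)) (fun b => expUnit (y b) * emlIterU l (bgUnits F K U₀) b) c : (Matrix (Fin 2) (Fin 2) ℂ)ˣ) : Matrix (Fin 2) (Fin 2) ℂ) *
            (((emlAvgU (emlIterU l (bgUnits F K U₀)) c)⁻¹ : (Matrix (Fin 2) (Fin 2) ℂ)ˣ) : Matrix (Fin 2) (Fin 2) ℂ))) 0 (Fm l X)) c'‖ := by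
  have h := l1_orbit_sub_lin_le_pow_of_lt (fun m => PBond (F.P K) m)
    (fun m => fun y : PBond (F.P K) m → Matrix (Fin 2) (Fin 2) ℂ => fun c : PBond (F.P K) (m + 1) =>
          mlog (((dbarCovU (emlIterU m (bgUnits F K U₀)) (fun b => expUnit (y b) * emlIterU m (bgUnits F K U₀) b) c : (Matrix (Fin 2) (Fin 2) ℂ)ˣ) : Matrix (Fin 2) (Fin 2) ℂ) *
            (((emlAvgU (emlIterU m (bgUnits F K U₀)) c)⁻¹ : (Matrix (Fin 2) (Fin 2) ℂ)ˣ) : Matrix (Fin 2) (Fin 2) ℂ)))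
    (fun m => fderiv ℂ (fun y : PBond (F.P K) m → Matrix (Fin 2) (Fin 2) ℂ => fun c : PBond (F.P K) (m + 1) =>
          mlog (((dbarCovU (emlIterU m (bgUnits F K U₀)) (fun b => expUnit (y b) * emlIterU m (bgUnits F K U₀) b) c : (Matrix (Fin 2) (Fin 2) ℂ)ˣ) : Matrix (Fin 2) (Fin 2) ℂ) *
            (((emlAvgU (emlIterU m (bgUnits F K U₀)) c)⁻¹ : (Matrix (Fin 2) (Fin 2) ℂ)ˣ) : Matrix (Fin 2) (Fin 2) ℂ))) 0)
    Lin hLin0 hLins (fun m => Fm m X) (fun m => hFs m X) k hκ hT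
  rwa [hF0] at h

/-- ★★★ **THE LEVEL-`k` TRUNCATED DEFECT TELESCOPE AT THE MEMBER, explicit damping `κ := (L²)⁻¹ + 2·10¹⁵·L³·ε₀`** (F2″-COV's column sum discharges `hT` for `m < k ≤ K − n`; window
`10¹³L³ε₀ ≤ 1`; no window on `X`). [cite: Balaban1985Averaging, (125)-(127) p.36, (150)-(152) p.40; Balaban1985Variational, (44)-(46) p.285; Balaban1984PropagatorsI, (1.18)-(1.20) pp.19-20] -/
theorem l1_iterate_sub_lin_le_damped_defects_of_regPr {ε₀ : ℝ} (hWε : 10 ^ 13 * (F.L : ℝ) ^ 3 * ε₀ ≤ 1)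
    (U₀ : GaugeField (F.P K) 0 (Matrix.specialUnitaryGroup (Fin 2) ℂ)) (hreg : RegPr F n K ε₀ U₀)
    (Fm : (m : ℕ) → (PBond (F.P K) 0 → Matrix (Fin 2) (Fin 2) ℂ) → (PBond (F.P K) m → Matrix (Fin 2) (Fin 2) ℂ)) (hF0 : ∀ x, Fm 0 x = x)
    (hFs : ∀ (m : ℕ) (x : PBond (F.P K) 0 → Matrix (Fin 2) (Fin 2) ℂ), Fm (m + 1) x =
        (fun y : PBond (F.P K) m → Matrix (Fin 2) (Fin 2) ℂ => fun c : PBond (F.P K) (m + 1) =>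
          mlog (((dbarCovU (emlIterU m (bgUnits F K U₀)) (fun b => expUnit (y b) * emlIterU m (bgUnits F K U₀) b) c : (Matrix (Fin 2) (Fin 2) ℂ)ˣ) : Matrix (Fin 2) (Fin 2) ℂ) *
            (((emlAvgU (emlIterU m (bgUnits F K U₀)) c)⁻¹ : (Matrix (Fin 2) (Fin 2) ℂ)ˣ) : Matrix (Fin 2) (Fin 2) ℂ))) (Fm m x))
    (Lin : (m : ℕ) → (PBond (F.P K) 0 → Matrix (Fin 2) (Fin 2) ℂ) →L[ℂ] (PBond (F.P K) m → Matrix (Fin 2) (Fin 2) ℂ))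
    (hLin0 : Lin 0 = ContinuousLinearMap.id ℂ (PBond (F.P K) 0 → Matrix (Fin 2) (Fin 2) ℂ))
    (hLins : ∀ m : ℕ, Lin (m + 1) =
        (fderiv ℂ (fun y : PBond (F.P K) m → Matrix (Fin 2) (Fin 2) ℂ => fun c : PBond (F.P K) (m + 1) =>
          mlog (((dbarCovU (emlIterU m (bgUnits F K U₀)) (fun b => expUnit (y b) * emlIterU m (bgUnits F K U₀) b) c : (Matrix (Fin 2) (Fin 2) ℂ)ˣ) : Matrix (Fin 2) (Fin 2) ℂ) *
            (((emlAvgU (emlIterU m (bgUnits F K U₀)) c)⁻¹ : (Matrix (Fin 2) (Fin 2) ℂ)ˣ) : Matrix (Fin 2) (Fin 2) ℂ))) 0).comp (Lin m))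
    (X : PBond (F.P K) 0 → Matrix (Fin 2) (Fin 2) ℂ) (k : ℕ) (hk : k ≤ K - n) :
    ∑ c : PBond (F.P K) k, ‖(Fm k X - Lin k X) c‖ ≤
      ∑ l ∈ Finset.range k, (((F.L : ℝ) ^ 2)⁻¹ + 2 * 10 ^ 15 * (F.L : ℝ) ^ 3 * ε₀) ^ (k - 1 - l) *
        ∑ c', ‖((fun y : PBond (F.P K) l → Matrix (Fin 2) (Fin 2) ℂ => fun c : PBond (F.P K) (l + 1) =>
          mlog (((dbarCovU (emlIterU l (bgUnits F K U₀)) (fun b => expUnit (y b) * emlIterU l (bgUnits F K U₀) b) c : (Matrix (Fin 2) (Fin 2) ℂ)ˣ) : Matrix (Fin 2) (Fin 2) ℂ) *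
            (((emlAvgU (emlIterU l (bgUnits F K U₀)) c)⁻¹ : (Matrix (Fin 2) (Fin 2) ℂ)ˣ) : Matrix (Fin 2) (Fin 2) ℂ))) (Fm l X) -
        fderiv ℂ (fun y : PBond (F.P K) l → Matrix (Fin 2) (Fin 2) ℂ => fun c : PBond (F.P K) (l + 1) =>
          mlog (((dbarCovU (emlIterU l (bgUnits F K U₀)) (fun b => expUnit (y b) * emlIterU l (bgUnits F K U₀) b) c : (Matrix (Fin 2) (Fin 2) ℂ)ˣ) : Matrix (Fin 2) (Fin 2) ℂ) *
            (((emlAvgU (emlIterU l (bgUnits F K U₀)) c)⁻¹ : (Matrix (Fin 2) (Fin 2) ℂ)ˣ) : Matrix (Fin 2) (Fin 2) ℂ))) 0 (Fm l X)) c'‖ := by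
  have hε₀ : 0 < ε₀ := pos_of_regPr F hreg
  have hκ : (0 : ℝ) ≤ ((F.L : ℝ) ^ 2)⁻¹ + 2 * 10 ^ 15 * (F.L : ℝ) ^ 3 * ε₀ := by positivity
  exact l1_iterate_sub_lin_le_damped_defects F U₀ Fm hF0 hFs Lin hLin0 hLins hκ k
    (fun m hm v => sum_norm_fderiv_dbarChartField_apply_le_of_regPr (F := F) (n := n) (K := K) hWε hreg (by omega) v) X

/-- ★★★ **THE LEVEL-`k` TRUNCATED DEFECT TELESCOPE AT THE MEMBER, IN LEVEL-MASS CURRENCY**: for `RegPr F n K ε₀ U₀`, `0 < e`, `10⁹L²e ≤ 1`, `10¹³L³ε₀ ≤ 1`, `‖X‖ < e·η` and every `k ≤ K − n`,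
`Σ_{c : PBond (F.P K) k} ‖(Fm k X − Lin k X) c‖ ≤ Σ_{l<k} κ^{k−1−l} · (10⁹L⁴ · Σ_b ‖Fm l X b‖²)`, `κ := (L²)⁻¹ + 2·10¹⁵·L³·ε₀` — the accumulated one-step defect of the (S)-chain truncated
at an intermediate level, which REM2ˢ's stair row `S_k` reads per link (px13 g6 LOCATE #57 §3).
[cite: Balaban1985Averaging, (125)-(127) p.36, (150)-(152) pp.40-41, (161)-(163) p.42; Balaban1985Variational, (44)-(46) p.285, Prop. 7 p.299; Balaban1984PropagatorsI, (1.18)-(1.20) pp.19-20] -/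
theorem l1_iterate_sub_lin_le_damped_levelMasses_of_regPr {ε₀ e : ℝ} (he : 0 < e) (hWe : 10 ^ 9 * (F.L : ℝ) ^ 2 * e ≤ 1) (hWε : 10 ^ 13 * (F.L : ℝ) ^ 3 * ε₀ ≤ 1)
    (U₀ : GaugeField (F.P K) 0 (Matrix.specialUnitaryGroup (Fin 2) ℂ)) (hreg : RegPr F n K ε₀ U₀)
    (Fm : (m : ℕ) → (PBond (F.P K) 0 → Matrix (Fin 2) (Fin 2) ℂ) → (PBond (F.P K) m → Matrix (Fin 2) (Fin 2) ℂ)) (hF0 : ∀ x, Fm 0 x = x)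
    (hFs : ∀ (m : ℕ) (x : PBond (F.P K) 0 → Matrix (Fin 2) (Fin 2) ℂ), Fm (m + 1) x =
        (fun y : PBond (F.P K) m → Matrix (Fin 2) (Fin 2) ℂ => fun c : PBond (F.P K) (m + 1) =>
          mlog (((dbarCovU (emlIterU m (bgUnits F K U₀)) (fun b => expUnit (y b) * emlIterU m (bgUnits F K U₀) b) c : (Matrix (Fin 2) (Fin 2) ℂ)ˣ) : Matrix (Fin 2) (Fin 2) ℂ) *
            (((emlAvgU (emlIterU m (bgUnits F K U₀)) c)⁻¹ : (Matrix (Fin 2) (Fin 2) ℂ)ˣ) : Matrix (Fin 2) (Fin 2) ℂ))) (Fm m x))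
    (Lin : (m : ℕ) → (PBond (F.P K) 0 → Matrix (Fin 2) (Fin 2) ℂ) →L[ℂ] (PBond (F.P K) m → Matrix (Fin 2) (Fin 2) ℂ))
    (hLin0 : Lin 0 = ContinuousLinearMap.id ℂ (PBond (F.P K) 0 → Matrix (Fin 2) (Fin 2) ℂ))
    (hLins : ∀ m : ℕ, Lin (m + 1) =
        (fderiv ℂ (fun y : PBond (F.P K) m → Matrix (Fin 2) (Fin 2) ℂ => fun c : PBond (F.P K) (m + 1) =>
          mlog (((dbarCovU (emlIterU m (bgUnits F K U₀)) (fun b => expUnit (y b) * emlIterU m (bgUnits F K U₀) b) c : (Matrix (Fin 2) (Fin 2) ℂ)ˣ) : Matrix (Fin 2) (Fin 2) ℂ) *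
            (((emlAvgU (emlIterU m (bgUnits F K U₀)) c)⁻¹ : (Matrix (Fin 2) (Fin 2) ℂ)ˣ) : Matrix (Fin 2) (Fin 2) ℂ))) 0).comp (Lin m))
    (X : PBond (F.P K) 0 → Matrix (Fin 2) (Fin 2) ℂ) (hXr : ‖X‖ < e * eta F n K) (k : ℕ) (hk : k ≤ K - n) :
    ∑ c : PBond (F.P K) k, ‖(Fm k X - Lin k X) c‖ ≤
      ∑ l ∈ Finset.range k, (((F.L : ℝ) ^ 2)⁻¹ + 2 * 10 ^ 15 * (F.L : ℝ) ^ 3 * ε₀) ^ (k - 1 - l) * (10 ^ 9 * (F.L : ℝ) ^ 4 * ∑ b : PBond (F.P K) l, ‖Fm l X b‖ ^ 2) := by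
  have hε₀ : 0 < ε₀ := pos_of_regPr F hreg
  have hL1 : (1 : ℝ) ≤ F.L := by exact_mod_cast F.hL.2.le
  have hL0 : (0 : ℝ) ≤ F.L := by linarith
  have hL3ε : (0 : ℝ) ≤ (F.L : ℝ) ^ 3 * ε₀ := by positivity
  have hWε12 : 10 ^ 12 * (F.L : ℝ) ^ 3 * ε₀ ≤ 1 := by nlinarith
  have hε7 : 10 ^ 7 * (F.L : ℝ) ^ 3 * ε₀ ≤ 1 := by nlinarith
  have hκ : (0 : ℝ) ≤ ((F.L : ℝ) ^ 2)⁻¹ + 2 * 10 ^ 15 * (F.L : ℝ) ^ 3 * ε₀ := by positivity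
  -- the level sup along the orbit (SUP-SEAM) and its smallness window for px15's one-step defect row
  set s : ℝ := 6 * (2 * e + 2700 * (F.L : ℝ) * ε₀) with hs
  have hs0 : 0 ≤ s := by rw [hs]; positivity
  have hsL : 100000 * (F.L : ℝ) * s ≤ 1 := by
    rw [hs]
    have h1 : 100000 * (F.L : ℝ) * (6 * (2 * e)) ≤ 1 / 4 := by nlinarith [mul_nonneg hL0 he.le]
    have h2 : 100000 * (F.L : ℝ) * (6 * (2700 * (F.L : ℝ) * ε₀)) ≤ 1 / 4 := by nlinarith [mul_nonneg hL0 hε₀.le, mul_nonneg (mul_nonneg hL0 hL0) hε₀.le]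
    nlinarith
  refine (l1_iterate_sub_lin_le_damped_defects_of_regPr F hWε U₀ hreg Fm hF0 hFs Lin hLin0 hLins X k hk).trans
    (Finset.sum_le_sum fun l hl => mul_le_mul_of_nonneg_left ?_ (pow_nonneg hκ _))
  have hl' : l + 1 ≤ K - n := by have := Finset.mem_range.1 hl; omega
  have hy : ∀ b : PBond (F.P K) l, ‖Fm l X b‖ ≤ s := fun b =>
    norm_iterate_apply_le_of_regPr F hε₀ he hWe hWε12 U₀ hreg Fm hF0 hFs X hXr (by omega) b
  have hrow := sum_norm_chartField_sub_fderiv_apply_le_of_regPr (F := F) (n := n) (K := K) hε7 hreg hl' hs0 hsL hy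
  exact le_trans (le_of_eq rfl) hrow

end Summit.QuantumFields.YangMills.Theorems.Prop7CovLogTowerDampedLevelK

end
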